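/-
Copyright (c) 2026 the pub-hodgecm-mathlib formalisation cell (harness21).  Prover seat hodgecm-mathlib-K2Liu-p12 (g4): Track B «K2-LIT»,
#184♮ = hLiu418 = stmt-HodgeConjecture-24832; Road Φ of socket #41, Φ9 consumer sheet row G2 «G2-rest» (LEAD F0P6-plan (g14) BATCH #28 (1)
2026-09-04T14:09:56Z; K2E5-plan (g7) BATCH #27 (3) (G2-alt)); census `K2/K2Liu-p12/g4/CENSUS-G2rest-GoodPlaceNonUnimodular.K2Liu-p12-g4.md`.  File R1 (local).
-/
import Summits.HodgeConjecture.HodgeConjecture.Theorems.K2LiuGoodPlaceWhittakerBound     -- ★ Φ4 (R-bound) (ii)(iii) (+ U1∕U1′∕U2∕F4b-2∕Φ5-tie∕F3b transitively)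
import Summits.HodgeConjecture.HodgeConjecture.Theorems.K2LiuSkewBallVolumeGrowth        -- ★ U3 `measure_ball_sub_le_pow_mul`
import Summits.HodgeConjecture.HodgeConjecture.Theorems.K2LiuLocalIntertwiningProperty  -- ★ `absDetDelta_pos` (`|det_Δ p|_v > 0` on `P_Δ(F_v)`, over ★ `isUnit_detDelta`)
import HarnessLib

/-!
# Crux `HLiu418`, Road Φ of socket #41, Φ9 sheet row G2 «G2-rest» — THE NON-UNIMODULAR UNRAMIFIED WHITTAKER FACTOR:
# ENTIRE, ONE BALL INTEGRAL OF RADIUS `3 + 2·ord_v(det β)`, BOUNDED BY `N_v^{3+2·ord_v(det β)} · μ_v(B_v(0))`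

Cell `hodgecm-mathlib`, crux item hLiu418 = `stmt-HodgeConjecture-24832`, route of record `HCCMUnconditional`; squad K2 ∕ K2Liu, road `K2_Liu`,
socket #41 `sig_K2LiuSiegelEisensteinContinuation`, Road Φ; consumer = the Φ9 sheet row G2 (★ (b) `K2LiuGoodPlaceWhittakerEulerAssembly`:
the finitely many places `v ∈ D(β) ∖ T` where the Fourier index `β` is `v`-integral but NOT `v`-unimodular are carried BY VALUE through the
letters `hWd` (holomorphy) of `differentiableOn_face` and the bound (A-13) `hWbound`).  THEOREMS ONLY (no `def`, no `instance`, no `notation`,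
no named-fact hypothesis, no `sorry`); lane `--supports stmt-HodgeConjecture-24832` (count-neutral helper; closes no socket by itself).

THE MATHEMATICS (typist check (G2-alt) of the census, §0: «G3's constant at the spherical vector is `v`-uniform of shape `q_v^{c}·|det β|_v^{−A}`»).
Frame ★ D10 `H(F_v)` at a GOOD place `v` of `F` (`|2|_w = 1` for all `w ∣ v`, `T = T₀ ⊗ 1` and `T⁻¹` integral, `χ_w` unitary unramified), `φ = (φ_s)_s`
the spherical FAMILY (★ `IsSphericalSection` at every `s`), `ψ_v`, `τ = tr_{E_v∕F_v}`, `ε`, `β` a `T`-skew Fourier index as in ★ Φ4 (R-bound).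
* §1 **`differentiable_goodPlace_whittaker`** — for EVERY radius `a` and EVERY `β`, `s ↦ ∫_{B(a)} φ_s(w_Δ n(t)) ψ_v(−τ tr(β t)) dμ` is ENTIRE.  This is ★ Φ5
  `differentiable_whittaker` with its two by-value letters discharged for the spherical family: `hdiff` — by the good-place Iwasawa decomposition `g = p k`
  (★ `exists_isSiegelDelta_mul_mem_localInt`) `φ_s(g) = χ_v(det_Δ p)·|det_Δ p|_v^{s+n∕2}` for ALL `s` at once, entire since `|det_Δ p|_v > 0` (★ `absDetDelta_pos`);
  `hbd` — `‖φ_s(w_Δ n(t))‖ = x(t)^{Re s + n∕2}` with `0 < x(t) = |det_Δ p(t)|_v ≤ 1` (★ U2 `absDetDelta_le_one_of_weylDelta_mul_nElem_eq`) is ANTITONE in `Re s`, so on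
  the disc `|s − s₀| < 1` it is bounded by its value at the real parameter `Re s₀ − 1 − n∕2`, which ★ F3b `exists_bound_pullback_of_isCompact` bounds on the compact ball
  (no lower content bound is needed).  Discharges (b)'s `hWd` at `v ∈ D(β)∖T`.
* §2 **`goodPlace_whittaker_norm_le_pow_mul`** — `‖∫_{B(−K)} …‖ ≤ N_v^K · μ(B(0))` for `Re s + n∕2 ≥ 0`, `K ∈ ℕ`, with the volume-growth base
  `N_v = ∏_{(i,j,w)} |ι_w(π)|_w⁻¹ = (∏_{w∣v}|π|_w⁻¹)^{n²}` (★ (iii) `goodPlace_whittaker_norm_le` + ★ U3 `measure_ball_sub_le_pow_mul`, read in `ℝ`).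
* §3 **`valued_inv_apply_le_of_det`** — THE ADJUGATE LETTER: `β` integral at every `w ∣ v` with `v_w(ι_w π)^e ≤ v_w((det β)_w)` for all `w` ⇒ the inverse
  `β⁻` (`ββ⁻ = 1`) lies in `ball(−e)` (`β⁻_w = (det β_w)⁻¹·adj(β_w)`, the adjugate of an integral matrix is integral) — so ★ (ii)'s `b′` is `e = ord_v(det β)`.
* §4 HEAD **`goodPlace_whittaker_nonUnimodular`** — for `β` `T`-skew, `v`-INTEGRAL (`b = 0`) with det-letter `e`:  (a) `∫_{B(−k)} = ∫_{B(−K_e)}` for every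
  `k ≥ K_e := 3 + |d| + 2|c_ε| + 2|c₂| + 2e` and EVERY `s` (★ (ii));  (b) `‖∫_{B(−K_e)}‖ ≤ N_v^{K_e} · μ(B(0))` for `Re s ≥ −n∕2` (§2);  (c) `s ↦ ∫_{B(−K_e)}` is entire (§1).
  At a good place `d = c_ε = c₂ = 0`, so `K_e = 3 + 2·ord_v(det β)` and the bound is `q_v^{6n²}·|det β|_v^{−4n²}·μ_v(B_v(0))` for the CM datum (`N_v = q_v^{2n²}`,
  ★ U3 docstring): ABSOLUTE exponents, uniform in `v` — the (A-13) `hWbound` letter of row G2; the product over `v ∈ D(β)∖T` and the uniform `1∕b^{D(β)∪T}` bound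
  are file R2 `K2LiuGoodPlaceWhittakerProductBound`.
HONEST LABEL.  Count-neutral helper; it retires nothing by itself: `HC_CM` is proved only modulo the 7 printed citations (2 remaining named inputs:
hLiu418 = `stmt-HodgeConjecture-24832`, h413 = `stmt-HodgeConjecture-24833`) until rung 0 closes.

## References
* [Casselman1980] W. Casselman, *The unramified principal series of p-adic groups I*, Compositio Math. 40 (1980), §3 (Iwasawa decomposition, spherical vector).
* [KudlaRallis1994] S. Kudla, S. Rallis, Ann. of Math. 140 (1994), §2 (local Whittaker functions of degenerate principal series: entire, lattice bounds).
* [Shimura1997] G. Shimura, *Euler products and Eisenstein series*, CBMS 93 (1997), §13 (local densities ∕ content), §18–§19 (local Whittaker integrals).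
-/

set_option autoImplicit false
-- the mandated namespace repeats the single-problem summit's segment (`HodgeConjecture.HodgeConjecture`)
set_option linter.dupNamespace false

noncomputable section

open scoped NNReal ENNReal Matrix Topology
open NumberField IsDedekindDomain Matrix MeasureTheory Set Filter Metric
open Literature.NumberTheory.GaloisRepresentations Literature.NumberTheory.GaloisRepresentations.IsNonarchimedeanLocalField
open Literature.NumberTheory.Automorphic Literature.NumberTheory.Automorphic.UnitaryGroup
open Literature.NumberTheory.GelbartRogawski1991.AdaptedBlocks
open Literature.NumberTheory.GelbartRogawski1991.UnitaryDualPair.LocalSplitting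
open Literature.NumberTheory.K2Lit.LocalSiegelDoubled
open Summit.HodgeConjecture.HodgeConjecture.Cruxes.HLiu418.K2LiuLocalRingValuationBalls
open Summit.HodgeConjecture.HodgeConjecture.Cruxes.HLiu418.K2LiuSkewLatticeShells
open Summit.HodgeConjecture.HodgeConjecture.Cruxes.HLiu418.K2LiuBadPlaceWhittakerEntire
open Summit.HodgeConjecture.HodgeConjecture.Cruxes.HLiu418.K2LiuSiegelWeylUnipotentContent
open Summit.HodgeConjecture.HodgeConjecture.Cruxes.HLiu418.K2LiuLocalSiegelIwasawa
open Summit.HodgeConjecture.HodgeConjecture.Cruxes.HLiu418.K2LiuSiegelSectionNorm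
open Summit.HodgeConjecture.HodgeConjecture.Cruxes.HLiu418.K2LiuLocalIntertwiningProperty (absDetDelta_pos)
open Summit.HodgeConjecture.HodgeConjecture.Cruxes.HLiu418.K2LiuGoodPlaceWhittakerBound
open Summit.HodgeConjecture.HodgeConjecture.Cruxes.HLiu418.K2LiuSkewBallVolumeGrowth

namespace Summit.HodgeConjecture.HodgeConjecture.Cruxes.HLiu418.K2LiuGoodPlaceWhittakerNonUnimodular

variable (F : Type) [Field F] [NumberField F] (E : Type) [Field E] [NumberField E] [Algebra F E]
  [Algebra.IsQuadraticExtension F E] (c : E ≃ₐ[F] E)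
  {δ : E} (hcδ : c δ = -δ) (hδ : δ ≠ 0) {dd : F} (hd : δ * δ = algebraMap F E dd)
  (v : HeightOneSpectrum (𝓞 F)) (n : ℕ) {T₀ : Matrix (Fin n) (Fin n) F} (hT₀ : T₀.IsSymm) (hT₀d : IsUnit T₀.det)
  {JD : Matrix (Fin (n + n)) (Fin (n + n)) E} (hJD : JD = (gramD F n T₀).map (algebraMap F E))
  {π : v.adicCompletion F} (hπ : Valued.v π = WithZero.exp (-1 : ℤ))

/-! ## §1 The spherical family's ball integrals are entire -/

section Entire

include hcδ hδ hd hT₀ hJD in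
/-- **THE MODULUS OF A SPHERICAL SECTION**: for `φ` spherical in `I_v(s, χ_v)` with `χ_v` unitary, `p ∈ P_Δ(F_v)`, `k ∈ K_v`:
`‖φ(p k)‖ = |det_Δ p|_v^{Re s + n∕2}`. [cite: Casselman1980, §3] [cite: KudlaRallis1994, §2] -/
theorem norm_apply_siegel_mul_localInt {χv : ∀ w : PlacesOver E v, (w.1.adicCompletion E)ˣ →* ℂˣ}
    (hχ1 : ∀ (w : PlacesOver E v) (x : (w.1.adicCompletion E)ˣ), ‖((χv w x : ℂˣ) : ℂ)‖ = 1) {s : ℂ}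
    {φ : UnitaryGroup.localPi E c (n + n) JD v → ℂ} (hφ : IsSphericalSection F E c hcδ hδ hd v n hT₀ hJD χv s φ)
    {p k : UnitaryGroup.localPi E c (n + n) JD v} (hp : IsSiegelDelta F E c hcδ hδ hd v n hT₀ hJD p)
    (hk : k ∈ UnitaryGroup.localInt E c (n + n) JD v) :
    ‖φ (p * k)‖ = absDetDelta F E c v n p ^ (s.re + (n : ℝ) / 2) := by
  rw [hφ.apply_siegel_mul_localInt hp hk, localSiegelCharacter, norm_mul, norm_chiDet_eq_one F E c v n hχ1, one_mul,
    Complex.norm_cpow_eq_rpow_re_of_pos (absDetDelta_pos F E c hcδ hδ hd v n hT₀ hJD hp)]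
  congr 1
  simp

include hcδ hδ hd hT₀ hT₀d hJD in
/-- **A SPHERICAL FAMILY IS ENTIRE IN `s` POINTWISE** at a good place (`|2|_w = 1`, `T₀`, `T₀⁻¹` integral — Iwasawa `H(F_v) = P_Δ(F_v)·K_v`, ★
`exists_isSiegelDelta_mul_mem_localInt`): for `g = p k`, `φ_s(g) = χ_v(det_Δ p)·|det_Δ p|_v^{s+n∕2}` for ALL `s`, an entire function of `s`
(`|det_Δ p|_v ≠ 0`). [cite: Casselman1980, §3] [cite: KudlaRallis1994, §2] -/
theorem differentiable_spherical_apply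
    (h2v : ∀ w : PlacesOver E v, ValuativeRel.valuation (w.1.adicCompletion E) (2 : w.1.adicCompletion E) = 1)
    (hT : ∀ (w : PlacesOver E v) (i j : Fin n),
      ValuativeRel.valuation (w.1.adicCompletion E) (algebraMap E (w.1.adicCompletion E) (algebraMap F E (T₀ i j))) ≤ 1)
    (hTinv : ∀ (w : PlacesOver E v) (i j : Fin n),
      ValuativeRel.valuation (w.1.adicCompletion E) (algebraMap E (w.1.adicCompletion E) (algebraMap F E (T₀⁻¹ i j))) ≤ 1)
    {χv : ∀ w : PlacesOver E v, (w.1.adicCompletion E)ˣ →* ℂˣ}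
    {φ : ℂ → UnitaryGroup.localPi E c (n + n) JD v → ℂ} (hφ : ∀ s, IsSphericalSection F E c hcδ hδ hd v n hT₀ hJD χv s (φ s))
    (g : UnitaryGroup.localPi E c (n + n) JD v) : Differentiable ℂ fun s => φ s g := by
  obtain ⟨p, k, hp, hk, rfl⟩ := exists_isSiegelDelta_mul_mem_localInt F E c hcδ hδ hd v n hT₀ hJD hT₀d h2v hT hTinv g
  have hfun : (fun s => φ s (p * k)) = fun s => ((chiDet F E c v n χv p : ℂˣ) : ℂ) * ((absDetDelta F E c v n p : ℂ) ^ (s + (n : ℂ) / 2)) := by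
    funext s
    rw [(hφ s).apply_siegel_mul_localInt hp hk, localSiegelCharacter]
  rw [hfun]
  have hne : (absDetDelta F E c v n p : ℂ) ≠ 0 :=
    Complex.ofReal_ne_zero.mpr (absDetDelta_pos F E c hcδ hδ hd v n hT₀ hJD hp).ne'
  exact (differentiable_const _).mul ((differentiable_id.add (differentiable_const _)).const_cpow (Or.inl hne))

include hcδ hδ hd hT₀ hT₀d hJD in
/-- **LOCALLY UNIFORM BOUND OF THE SPHERICAL FAMILY ON THE BIG CELL** (the `hbd` letter of ★ `differentiable_whittaker`): for every `s₀` there is `C`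
with `‖φ_s(w_Δ n(t))‖ ≤ C` for all `|s − s₀| < 1` and all skew `t` in the compact ball `B(a)`.  Proof: `‖φ_s(w_Δ n(t))‖ = x(t)^{Re s + n∕2}` with
`0 < x(t) = |det_Δ p(t)|_v ≤ 1` (★ U2), antitone in `Re s`; at the real parameter `s₁ = Re s₀ − 1` the continuous `φ_{s₁}` is bounded on `B(a)`.
[cite: Casselman1980, §3] [cite: KudlaRallis1994, §2] [cite: Shimura1997, §18] -/
theorem exists_bound_spherical_weylDelta_mul_nElem
    (S : AddSubgroup (Matrix (Fin n) (Fin n) (LocalRing E v)))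
    (hS : ∀ t, t ∈ S ↔ (t.map (conjLocal E c v))ᵀ * gramS F E v n T₀ + gramS F E v n T₀ * t = 0)
    (h2v : ∀ w : PlacesOver E v, ValuativeRel.valuation (w.1.adicCompletion E) (2 : w.1.adicCompletion E) = 1)
    (hT : ∀ (w : PlacesOver E v) (i j : Fin n),
      ValuativeRel.valuation (w.1.adicCompletion E) (algebraMap E (w.1.adicCompletion E) (algebraMap F E (T₀ i j))) ≤ 1)
    (hTinv : ∀ (w : PlacesOver E v) (i j : Fin n),
      ValuativeRel.valuation (w.1.adicCompletion E) (algebraMap E (w.1.adicCompletion E) (algebraMap F E (T₀⁻¹ i j))) ≤ 1)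
    {χv : ∀ w : PlacesOver E v, (w.1.adicCompletion E)ˣ →* ℂˣ} (hχ1 : ∀ (w : PlacesOver E v) (x : (w.1.adicCompletion E)ˣ), ‖((χv w x : ℂˣ) : ℂ)‖ = 1)
    {φ : ℂ → UnitaryGroup.localPi E c (n + n) JD v → ℂ} (hφ : ∀ s, IsSphericalSection F E c hcδ hδ hd v n hT₀ hJD χv s (φ s))
    {K : Set S} (hK : IsCompact K) (s₀ : ℂ) :
    ∃ r > 0, ∃ C : ℝ, ∀ s ∈ ball s₀ r, ∀ t ∈ K, ‖φ s (weylDelta F E c v n hJD * nElem F E c v n hJD t.1 ((hS t.1).1 t.2))‖ ≤ C := by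
  -- the real parameter at the left end of the disc
  set s₁ : ℂ := ((s₀.re - 1 : ℝ) : ℂ) with hs₁
  have hfc : Continuous (φ s₁) :=
    continuous_of_rightInvariant (UnitaryGroup.isOpen_localInt E c (n + n) JD v) fun g k hk => (hφ s₁).apply_mul_of_mem_localInt hk g
  obtain ⟨C, hC⟩ := exists_bound_pullback_of_isCompact F E c v n hJD S hS hfc hK
  refine ⟨1, one_pos, C, fun s hs t ht => ?_⟩
  obtain ⟨p, k, hp, hk, hg⟩ := exists_isSiegelDelta_mul_mem_localInt F E c hcδ hδ hd v n hT₀ hJD hT₀d h2v hT hTinv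
    (weylDelta F E c v n hJD * nElem F E c v n hJD t.1 ((hS t.1).1 t.2))
  obtain ⟨-, hle⟩ := absDetDelta_le_one_of_weylDelta_mul_nElem_eq F E c hcδ hδ hd v n hT₀ hJD h2v t.1 ((hS t.1).1 t.2) hp hk hg
  have hpos := absDetDelta_pos F E c hcδ hδ hd v n hT₀ hJD hp
  have h1 := hC t ht
  rw [hg] at h1 ⊢
  rw [norm_apply_siegel_mul_localInt F E c hcδ hδ hd v n hT₀ hJD hχ1 (hφ s) hp hk]
  rw [norm_apply_siegel_mul_localInt F E c hcδ hδ hd v n hT₀ hJD hχ1 (hφ s₁) hp hk] at h1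
  have hre : s₁.re = s₀.re - 1 := by rw [hs₁, Complex.ofReal_re]
  have hs' : s₀.re - 1 ≤ s.re := by
    have h := (Complex.abs_re_le_norm (s - s₀)).trans_lt (mem_ball_iff_norm.mp hs)
    rw [Complex.sub_re] at h
    have := (abs_lt.mp h).1
    linarith
  calc absDetDelta F E c v n p ^ (s.re + (n : ℝ) / 2)
      ≤ absDetDelta F E c v n p ^ (s₁.re + (n : ℝ) / 2) :=
        Real.rpow_le_rpow_of_exponent_ge hpos hle (by rw [hre]; linarith)
    _ ≤ C := h1

include hcδ hδ hd hT₀ hT₀d hJD hπ in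
/-- **§1 HEAD — THE GOOD-PLACE SPHERICAL WHITTAKER BALL INTEGRALS ARE ENTIRE.**  At a good place (`|2|_w = 1`, `T₀`, `T₀⁻¹` integral) for the spherical
family `φ` of `I_v(s, χ_v)` (`χ_v` unitary), every radius `a` and every `β`:  `s ↦ ∫_{B(a)} φ_s(w_Δ n(t))·ψ_v(−τ tr(β t)) dμ` is `Differentiable ℂ`
(★ Φ5 `differentiable_whittaker`, its letters `hdiff`∕`hbd` discharged by `differentiable_spherical_apply` ∕ `exists_bound_spherical_weylDelta_mul_nElem`).
This is the `hWd` letter of ★ (b) `differentiableOn_face` at the places `v ∈ D(β) ∖ T`. [cite: KudlaRallis1994, §2] [cite: Shimura1997, §18] [cite: Casselman1980, §3] -/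
theorem differentiable_goodPlace_whittaker
    (S : AddSubgroup (Matrix (Fin n) (Fin n) (LocalRing E v)))
    (hS : ∀ t, t ∈ S ↔ (t.map (conjLocal E c v))ᵀ * gramS F E v n T₀ + gramS F E v n T₀ * t = 0)
    [MeasurableSpace S] [BorelSpace S] (μ : Measure S) [μ.IsAddHaarMeasure]
    (h2v : ∀ w : PlacesOver E v, ValuativeRel.valuation (w.1.adicCompletion E) (2 : w.1.adicCompletion E) = 1)
    (hT : ∀ (w : PlacesOver E v) (i j : Fin n),
      ValuativeRel.valuation (w.1.adicCompletion E) (algebraMap E (w.1.adicCompletion E) (algebraMap F E (T₀ i j))) ≤ 1)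
    (hTinv : ∀ (w : PlacesOver E v) (i j : Fin n),
      ValuativeRel.valuation (w.1.adicCompletion E) (algebraMap E (w.1.adicCompletion E) (algebraMap F E (T₀⁻¹ i j))) ≤ 1)
    {χv : ∀ w : PlacesOver E v, (w.1.adicCompletion E)ˣ →* ℂˣ} (hχ1 : ∀ (w : PlacesOver E v) (x : (w.1.adicCompletion E)ˣ), ‖((χv w x : ℂˣ) : ℂ)‖ = 1)
    {φ : ℂ → UnitaryGroup.localPi E c (n + n) JD v → ℂ} (hφ : ∀ s, IsSphericalSection F E c hcδ hδ hd v n hT₀ hJD χv s (φ s))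
    {ψ : AddChar (v.adicCompletion F) Circle} (hψ : Continuous ψ) {τ : LocalRing E v → v.adicCompletion F} (hτc : Continuous τ)
    (β : Matrix (Fin n) (Fin n) (LocalRing E v)) (a : ℤ) :
    Differentiable ℂ fun s => ∫ t in {t : S | ∀ i j (w : PlacesOver E v), Valued.v (t.1 i j w) ≤ Valued.v (toPlace v w π) ^ a},
      φ s (weylDelta F E c v n hJD * nElem F E c v n hJD t.1 ((hS t.1).1 t.2)) * ((ψ (-τ (Matrix.trace (β * t.1))) : Circle) : ℂ) ∂μ := by
  have hfc : ∀ s, Continuous (φ s) := fun s =>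
    continuous_of_rightInvariant (UnitaryGroup.isOpen_localInt E c (n + n) JD v) fun g k hk => (hφ s).apply_mul_of_mem_localInt hk g
  exact differentiable_whittaker F E c v n hJD hπ S hS μ hfc
    (fun g => differentiable_spherical_apply F E c hcδ hδ hd v n hT₀ hT₀d hJD h2v hT hTinv hφ g) a
    (fun s₀ => exists_bound_spherical_weylDelta_mul_nElem F E c hcδ hδ hd v n hT₀ hT₀d hJD S hS h2v hT hTinv hχ1 hφ
      (isCompact_ball F E c v hπ n S hS a) s₀) hψ hτc β

end Entire

/-! ## §2 The volume bound in the `N_v^K` currency -/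

section Volume

include hcδ hδ hd hT₀ hT₀d hJD hπ in
/-- **`‖∫_{B(−K)} φ_s(w_Δ n(t)) ψ_v(−τ tr(β t)) dμ‖ ≤ N_v^K · μ(B(0))`** for `Re s + n∕2 ≥ 0`, `K ∈ ℕ`, EVERY `β`, with
`N_v = ∏_{(i,j,w)} |ι_w(π)|_w⁻¹` (★ (iii) `goodPlace_whittaker_norm_le`: `≤ μ(B(−K))`; ★ U3 `measure_ball_sub_le_pow_mul`: `μ(B(−K)) ≤ N_v^K μ(B(0))`, read in `ℝ`).
[cite: Shimura1997, §13, §18] [cite: KudlaRallis1994, §2] -/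
theorem goodPlace_whittaker_norm_le_pow_mul
    (S : AddSubgroup (Matrix (Fin n) (Fin n) (LocalRing E v)))
    (hS : ∀ t, t ∈ S ↔ (t.map (conjLocal E c v))ᵀ * gramS F E v n T₀ + gramS F E v n T₀ * t = 0)
    [MeasurableSpace S] [BorelSpace S] (μ : Measure S) [μ.IsAddHaarMeasure]
    (h2v : ∀ w : PlacesOver E v, ValuativeRel.valuation (w.1.adicCompletion E) (2 : w.1.adicCompletion E) = 1)
    (hT : ∀ (w : PlacesOver E v) (i j : Fin n),
      ValuativeRel.valuation (w.1.adicCompletion E) (algebraMap E (w.1.adicCompletion E) (algebraMap F E (T₀ i j))) ≤ 1)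
    (hTinv : ∀ (w : PlacesOver E v) (i j : Fin n),
      ValuativeRel.valuation (w.1.adicCompletion E) (algebraMap E (w.1.adicCompletion E) (algebraMap F E (T₀⁻¹ i j))) ≤ 1)
    {χv : ∀ w : PlacesOver E v, (w.1.adicCompletion E)ˣ →* ℂˣ} (hχ1 : ∀ (w : PlacesOver E v) (x : (w.1.adicCompletion E)ˣ), ‖((χv w x : ℂˣ) : ℂ)‖ = 1)
    {s : ℂ} (hs : 0 ≤ s.re + (n : ℝ) / 2) {φs : UnitaryGroup.localPi E c (n + n) JD v → ℂ}
    (hφ : IsSphericalSection F E c hcδ hδ hd v n hT₀ hJD χv s φs)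
    {ψ : AddChar (v.adicCompletion F) Circle} (τ : LocalRing E v → v.adicCompletion F) (β : Matrix (Fin n) (Fin n) (LocalRing E v)) (K : ℕ) :
    ‖∫ t in {t : S | ∀ i j (w : PlacesOver E v), Valued.v (t.1 i j w) ≤ Valued.v (toPlace v w π) ^ (-(K : ℤ))},
        φs (weylDelta F E c v n hJD * nElem F E c v n hJD t.1 ((hS t.1).1 t.2)) * ((ψ (-τ (Matrix.trace (β * t.1))) : Circle) : ℂ) ∂μ‖ ≤
      ((∏ p : Fin n × Fin n × PlacesOver E v, ((normAbs (p.2.2.1.adicCompletion E) (toPlace v p.2.2 π) : ℝ≥0∞))⁻¹) ^ K).toReal *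
        μ.real {t : S | ∀ i j (w : PlacesOver E v), Valued.v (t.1 i j w) ≤ Valued.v (toPlace v w π) ^ (0 : ℤ)} := by
  refine (goodPlace_whittaker_norm_le F E c hcδ hδ hd v n hT₀ hT₀d hJD hπ S hS μ h2v hT hTinv hχ1 hs hφ τ β K).trans ?_
  have h := measure_ball_sub_le_pow_mul F E c v hπ n S hS μ 0 K
  rw [zero_sub] at h
  have hfin : (∏ p : Fin n × Fin n × PlacesOver E v, ((normAbs (p.2.2.1.adicCompletion E) (toPlace v p.2.2 π) : ℝ≥0∞))⁻¹) ^ K *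
      μ {t : S | ∀ i j (w : PlacesOver E v), Valued.v (t.1 i j w) ≤ Valued.v (toPlace v w π) ^ (0 : ℤ)} ≠ ∞ := by
    refine ENNReal.mul_ne_top (ENNReal.pow_ne_top (ENNReal.prod_ne_top fun p _ => ENNReal.inv_ne_top.mpr ?_)) (measure_ball_ne_top F E c v hπ n S hS μ 0)
    have hπw : toPlace v p.2.2 π ≠ 0 := (uniformizer_ne_zero F v hπ) ∘ fun h => (map_eq_zero_iff _ (toPlace v p.2.2).injective).mp h
    exact ENNReal.coe_ne_zero.mpr ((map_ne_zero (normAbs (p.2.2.1.adicCompletion E))).mpr hπw)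
  rw [measureReal_def, measureReal_def, ← ENNReal.toReal_mul]
  exact ENNReal.toReal_mono hfin h

end Volume

/-! ## §3 The adjugate letter: `β` integral with `v_w(ϖ)^e ≤ v_w(det β)` ⇒ `β⁻ ∈ ball(−e)` -/

section Adjugate

/-- generic: over a valued field, the ADJUGATE of a matrix with entries of valuation `≤ 1` has entries of valuation `≤ 1` (the adjugate commutes with
the inclusion of the valuation ring, Mathlib `RingHom.map_adjugate`). [folklore] -/
theorem valued_adjugate_apply_le_one {K : Type*} [Field K] {Γ₀ : Type*} [LinearOrderedCommGroupWithZero Γ₀] [Valued K Γ₀]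
    {m : Type*} [Fintype m] [DecidableEq m] {A : Matrix m m K} (hA : ∀ i j, Valued.v (A i j) ≤ 1) (i j : m) :
    Valued.v (A.adjugate i j) ≤ 1 := by
  set A₀ : Matrix m m (Valued.v (R := K)).integer := fun i j => ⟨A i j, hA i j⟩ with hA₀def
  have hA₀ : A = (Valued.v (R := K)).integer.subtype.mapMatrix A₀ := by
    ext i j; rfl
  rw [hA₀, ← RingHom.map_adjugate, RingHom.mapMatrix_apply, Matrix.map_apply]
  exact (A₀.adjugate i j).2

variable {E v n} in
omit [Algebra.IsQuadraticExtension F E] in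
include hπ in
/-- **THE ADJUGATE LETTER** (the `b′` of ★ (ii) from `ord_v(det β)`).  In `M_n(E ⊗ F_v) = Π_{w∣v} M_n(E_w)`: if `β β⁻ = 1`, every entry of `β` is
integral at every `w ∣ v`, and `v_w(ι_w π)^e ≤ v_w((det β)_w)` for all `w`, then `v_w(β⁻_{ijw}) ≤ v_w(ι_w π)^{−e}` — `β⁻ ∈ ball(−e)`
(`β⁻_w = β_w⁻¹ = (det β_w)⁻¹ · adj(β_w)` with `adj(β_w)` integral). [cite: Shimura1997, §13] -/
theorem valued_inv_apply_le_of_det {β βinv : Matrix (Fin n) (Fin n) (LocalRing E v)} (hββ : β * βinv = 1)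
    (hβint : ∀ i j (w : PlacesOver E v), Valued.v (β i j w) ≤ 1) {e : ℕ}
    (hdet : ∀ w : PlacesOver E v, Valued.v (toPlace v w π) ^ (e : ℤ) ≤ Valued.v (β.det w))
    (i j : Fin n) (w : PlacesOver E v) : Valued.v (βinv i j w) ≤ Valued.v (toPlace v w π) ^ (-(e : ℤ)) := by
  classical
  set ev : LocalRing E v →+* w.1.adicCompletion E := Pi.evalRingHom (fun w : PlacesOver E v => w.1.adicCompletion E) w with hev
  set βw : Matrix (Fin n) (Fin n) (w.1.adicCompletion E) := ev.mapMatrix β with hβw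
  set βiw : Matrix (Fin n) (Fin n) (w.1.adicCompletion E) := ev.mapMatrix βinv with hβiw
  have hmul : βw * βiw = 1 := by rw [hβw, hβiw, ← map_mul, hββ, map_one]
  have hdetw : β.det w = βw.det := by rw [hβw, ← RingHom.map_det]; rfl
  have hπ0 : Valued.v (toPlace v w π) ≠ 0 := valued_toPlace_uniformizer_ne_zero F E v hπ w
  have hpow0 : 0 < Valued.v (toPlace v w π) ^ (e : ℤ) := zero_lt_iff.mpr (zpow_ne_zero _ hπ0)
  have hdet' : Valued.v (toPlace v w π) ^ (e : ℤ) ≤ Valued.v βw.det := hdetw ▸ hdet w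
  have hdet0 : βw.det ≠ 0 := fun h => by
    rw [h, map_zero] at hdet'
    exact (not_le.mpr hpow0) hdet'
  have hinv : βiw = βw⁻¹ := (Matrix.inv_eq_right_inv hmul).symm
  have hentry : βinv i j w = βiw i j := by rw [hβiw, RingHom.mapMatrix_apply, Matrix.map_apply, hev]; rfl
  have hadj : Valued.v (βw.adjugate i j) ≤ 1 :=
    valued_adjugate_apply_le_one (fun i j => by rw [hβw, RingHom.mapMatrix_apply, Matrix.map_apply, hev]; exact hβint i j w) i j
  rw [hentry, hinv, Matrix.inv_def, Ring.inverse_eq_inv', Matrix.smul_apply, smul_eq_mul, map_mul, map_inv₀, _root_.zpow_neg]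
  calc (Valued.v βw.det)⁻¹ * Valued.v (βw.adjugate i j)
      ≤ (Valued.v βw.det)⁻¹ * 1 := by gcongr
    _ = (Valued.v βw.det)⁻¹ := mul_one _
    _ ≤ (Valued.v (toPlace v w π) ^ (e : ℤ))⁻¹ := inv_anti₀ hpow0 hdet'

end Adjugate

/-! ## §4 The head: the non-unimodular unramified Whittaker factor -/

section Head

include hcδ hδ hd hT₀ hT₀d hJD hπ in
/-- **THE NON-UNIMODULAR UNRAMIFIED WHITTAKER FACTOR** (row G2's `v ∈ D(β) ∖ T`; the (A-13) `hWbound` letter and (b)'s `hWd` letter at once).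
Good place `v` (`|2|_w = 1`, `T = T₀ ⊗ 1` and `T⁻¹` integral, both in ★ (ii)'s `gramS`-currency `hTb`∕`hTib` and in ★ (iii)'s `algebraMap`-currency `hT`∕`hTinv`),
`χ_v` unitary (`hχ1`) and unramified (`hχur`), the spherical family `φ` (`hφ`), `ψ_v` continuous of conductor exponent `d`, `τ = tr` (`hτ…`), `ε` anti-invariant
integral with `v_w(ι_w π)^{c_ε} ≤ v_w(2ε)`, `v_w(ι_w π)^{c₂} ≤ v_w(2)`; `β` `T`-skew, `v`-INTEGRAL, `ββ⁻ = 1`, with det-letter `v_w(ι_w π)^e ≤ v_w((det β)_w)`.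
With `K_e := 3 + |d| + 2|c_ε| + 2|c₂| + 2e` and `N_v := ∏_{(i,j,w)} |ι_w π|_w⁻¹`:
(a) `∫_{B(−k)} φ_s(w_Δ n(t)) ψ_v(−τ tr(β t)) dμ = ∫_{B(−K_e)} (same)` for every `k ≥ K_e` and EVERY `s` (★ (ii), `b = 0`, `b′ = e` by §3);
(b) `‖∫_{B(−K_e)} (same)‖ ≤ N_v^{K_e} · μ(B(0))` for `Re s + n∕2 ≥ 0` (§2);  (c) `s ↦ ∫_{B(−K_e)} (same)` is entire (§1).
At a good place `d = c_ε = c₂ = 0`: radius `3 + 2·ord_v(det β)`, bound `N_v^{3+2·ord_v(det β)}·μ_v(B_v(0))` — ABSOLUTE exponents, uniform in `v`.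
[cite: KudlaRallis1994, §2] [cite: Shimura1997, §13, §18–§19] [cite: Casselman1980, §3] -/
theorem goodPlace_whittaker_nonUnimodular
    (S : AddSubgroup (Matrix (Fin n) (Fin n) (LocalRing E v)))
    (hS : ∀ t, t ∈ S ↔ (t.map (conjLocal E c v))ᵀ * gramS F E v n T₀ + gramS F E v n T₀ * t = 0)
    [MeasurableSpace S] [BorelSpace S] [LocallyCompactSpace S] (μ : Measure S) [μ.IsAddHaarMeasure] [μ.Regular]
    [MeasurableSpace (v.adicCompletion F)] [BorelSpace (v.adicCompletion F)] (μF : Measure (v.adicCompletion F)) [μF.IsAddHaarMeasure]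
    (h2v : ∀ w : PlacesOver E v, ValuativeRel.valuation (w.1.adicCompletion E) (2 : w.1.adicCompletion E) = 1)
    (hTb : ∀ i j (w : PlacesOver E v), Valued.v (gramS F E v n T₀ i j w) ≤ Valued.v (toPlace v w π) ^ (0 : ℤ))
    (hTib : ∀ i j (w : PlacesOver E v), Valued.v ((gramS F E v n T₀)⁻¹ i j w) ≤ Valued.v (toPlace v w π) ^ (0 : ℤ))
    (hT : ∀ (w : PlacesOver E v) (i j : Fin n),
      ValuativeRel.valuation (w.1.adicCompletion E) (algebraMap E (w.1.adicCompletion E) (algebraMap F E (T₀ i j))) ≤ 1)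
    (hTinv : ∀ (w : PlacesOver E v) (i j : Fin n),
      ValuativeRel.valuation (w.1.adicCompletion E) (algebraMap E (w.1.adicCompletion E) (algebraMap F E (T₀⁻¹ i j))) ≤ 1)
    {χv : ∀ w : PlacesOver E v, (w.1.adicCompletion E)ˣ →* ℂˣ}
    (hχ1 : ∀ (w : PlacesOver E v) (x : (w.1.adicCompletion E)ˣ), ‖((χv w x : ℂˣ) : ℂ)‖ = 1)
    (hχur : ∀ (w : PlacesOver E v) (x : (w.1.adicCompletion E)ˣ), Valued.v (x : w.1.adicCompletion E) = 1 → χv w x = 1)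
    {φ : ℂ → UnitaryGroup.localPi E c (n + n) JD v → ℂ} (hφ : ∀ s, IsSphericalSection F E c hcδ hδ hd v n hT₀ hJD χv s (φ s))
    {ψ : AddChar (v.adicCompletion F) Circle} (hψ : Continuous ψ) {d : ℤ} (hdψ : ψ.HasConductorExp d)
    {τ : LocalRing E v → v.adicCompletion F} (hτ : ∀ r, toLocalRing E v (τ r) = r + conjLocal E c v r) (hτadd : ∀ r s, τ (r + s) = τ r + τ s)
    (hτs : ∀ (z : v.adicCompletion F) (r : LocalRing E v), τ (toLocalRing E v z * r) = z * τ r) (hτc : Continuous τ)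
    {ε : LocalRing E v} (hεσ : conjLocal E c v ε = -ε) (hεint : ∀ w : PlacesOver E v, Valued.v (ε w) ≤ 1) {cε c₂ : ℤ}
    (hε : ∀ w : PlacesOver E v, Valued.v (toPlace v w π) ^ cε ≤ Valued.v ((2 * ε) w))
    (h2 : ∀ w : PlacesOver E v, Valued.v (toPlace v w π) ^ c₂ ≤ Valued.v ((2 : LocalRing E v) w))
    {β βinv : Matrix (Fin n) (Fin n) (LocalRing E v)}
    (hβskew : (β.map (conjLocal E c v))ᵀ * gramS F E v n T₀ + gramS F E v n T₀ * β = 0) (hββ : β * βinv = 1)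
    (hβint : ∀ i j (w : PlacesOver E v), Valued.v (β i j w) ≤ 1) {e : ℕ}
    (hdet : ∀ w : PlacesOver E v, Valued.v (toPlace v w π) ^ (e : ℤ) ≤ Valued.v (β.det w)) :
    (∀ (s : ℂ) {k : ℤ}, 3 + |d| + 2 * |cε| + 2 * |c₂| + 2 * (e : ℤ) ≤ k →
      ∫ t in {t : S | ∀ i j (w : PlacesOver E v), Valued.v (t.1 i j w) ≤ Valued.v (toPlace v w π) ^ (-k)},
          φ s (weylDelta F E c v n hJD * nElem F E c v n hJD t.1 ((hS t.1).1 t.2)) * ((ψ (-τ (Matrix.trace (β * t.1))) : Circle) : ℂ) ∂μ =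
        ∫ t in {t : S | ∀ i j (w : PlacesOver E v), Valued.v (t.1 i j w) ≤ Valued.v (toPlace v w π) ^ (-(3 + |d| + 2 * |cε| + 2 * |c₂| + 2 * (e : ℤ)))},
          φ s (weylDelta F E c v n hJD * nElem F E c v n hJD t.1 ((hS t.1).1 t.2)) * ((ψ (-τ (Matrix.trace (β * t.1))) : Circle) : ℂ) ∂μ) ∧
    (∀ s : ℂ, 0 ≤ s.re + (n : ℝ) / 2 →
      ‖∫ t in {t : S | ∀ i j (w : PlacesOver E v), Valued.v (t.1 i j w) ≤ Valued.v (toPlace v w π) ^ (-(3 + |d| + 2 * |cε| + 2 * |c₂| + 2 * (e : ℤ)))},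
          φ s (weylDelta F E c v n hJD * nElem F E c v n hJD t.1 ((hS t.1).1 t.2)) * ((ψ (-τ (Matrix.trace (β * t.1))) : Circle) : ℂ) ∂μ‖ ≤
        ((∏ p : Fin n × Fin n × PlacesOver E v, ((normAbs (p.2.2.1.adicCompletion E) (toPlace v p.2.2 π) : ℝ≥0∞))⁻¹) ^
            (3 + d.natAbs + 2 * cε.natAbs + 2 * c₂.natAbs + 2 * e)).toReal *
          μ.real {t : S | ∀ i j (w : PlacesOver E v), Valued.v (t.1 i j w) ≤ Valued.v (toPlace v w π) ^ (0 : ℤ)}) ∧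
    Differentiable ℂ fun s => ∫ t in {t : S | ∀ i j (w : PlacesOver E v), Valued.v (t.1 i j w) ≤
        Valued.v (toPlace v w π) ^ (-(3 + |d| + 2 * |cε| + 2 * |c₂| + 2 * (e : ℤ)))},
      φ s (weylDelta F E c v n hJD * nElem F E c v n hJD t.1 ((hS t.1).1 t.2)) * ((ψ (-τ (Matrix.trace (β * t.1))) : Circle) : ℂ) ∂μ := by
  have hβ0 : ∀ i j (w : PlacesOver E v), Valued.v (β i j w) ≤ Valued.v (toPlace v w π) ^ (-(0 : ℤ)) := fun i j w => by
    rw [neg_zero, zpow_zero]; exact hβint i j w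
  have hβinv : ∀ i j (w : PlacesOver E v), Valued.v (βinv i j w) ≤ Valued.v (toPlace v w π) ^ (-(e : ℤ)) :=
    valued_inv_apply_le_of_det F hπ hββ hβint hdet
  have hcast : ((3 + d.natAbs + 2 * cε.natAbs + 2 * c₂.natAbs + 2 * e : ℕ) : ℤ) = 3 + |d| + 2 * |cε| + 2 * |c₂| + 2 * (e : ℤ) := by
    push_cast [Int.natCast_natAbs]; ring
  refine ⟨fun s k hk => ?_, fun s hs => ?_, ?_⟩
  · have h := goodPlace_whittaker_setIntegral_ball_eq F E c hcδ hδ hd v n hT₀ hT₀d hJD hπ S hS μ μF h2v hTb hTib hχur hφ hψ hdψ hτ hτadd hτs hτc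
      hεσ hεint hε h2 le_rfl (Int.natCast_nonneg e) hβskew hββ hβ0 hβinv s (k := k) (by linarith)
    rw [show 3 + |d| + 2 * |cε| + 2 * |c₂| + 4 * 0 + 2 * (e : ℤ) = 3 + |d| + 2 * |cε| + 2 * |c₂| + 2 * (e : ℤ) by ring] at h
    exact h
  · have h := goodPlace_whittaker_norm_le_pow_mul F E c hcδ hδ hd v n hT₀ hT₀d hJD hπ S hS μ h2v hT hTinv hχ1 hs (hφ s) τ β
      (ψ := ψ) (3 + d.natAbs + 2 * cε.natAbs + 2 * c₂.natAbs + 2 * e)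
    rw [hcast] at h
    exact h
  · exact differentiable_goodPlace_whittaker F E c hcδ hδ hd v n hT₀ hT₀d hJD hπ S hS μ h2v hT hTinv hχ1 hφ hψ hτc β _

end Head

end Summit.HodgeConjecture.HodgeConjecture.Cruxes.HLiu418.K2LiuGoodPlaceWhittakerNonUnimodular

end
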